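import Summits.CriticalPhenomena.CardyFormulaZ2.Theorems.CardySusyWardParafermionFamiliesToSLESixFluxPropagation

/-!
# The strip anchor (stub S5 of line `strip-anchored-vertex-normalisation`, crux stmt-CriticalPhenomena-10814):
# SUPPORT — unfolding the wall flux at a straight diagonal free wall

Helper file for `stub_anchoredWallFlux` (conditional form `IkhlefPonsaingFirstPassage → AnchoredWallFlux`).
On the discretised diagonal square `{|x₀ + x₁| ≤ L, |x₀ − x₁| ≤ L}` (all lattice points inside are
mesh-domain points, `ℤ²`-neighbours inside are domain-adjacent, the discrete boundary is the two outer
levels / columns, inner faces by level / column — the hypotheses `hmesh`, `hadj`, `hbd`, `hface` supplied by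
the anchor geometry), we decide which medial vertices near the free wall `x₀ + x₁ = L` are interior
(`IsInteriorMV`, level `≤ L − 3`), unfold the wall flux `wallFlux χ E E.δ U` (a `finsum`) into a finite sum,
and find that only the medial vertices of level EXACTLY `L − 3` contribute, each through its single
non-interior twin (the `NE` corner, coefficient `−χ`): the flux dart `cornerObs E E.δ w (w − cornerUnit i)`
of the wall site `w` of level `L − 2` above it.  Given the dart evaluations
`cornerObs … = sixthPhase (τ ± 1) · P w` (hypotheses `hout` / `hin`, the shape delivered by the touch
analysis), the flux is `−χ · sixthPhase τ · Σ_w P w · e^{∓iπ/6}` and its norm is at least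
`cos(π/6) · Σ_{w ∈ W} P w = (√3/2) · Σ_{w ∈ W} P w` for every finite set `W` of wall sites whose outgoing
dart lies in the window (`S5.norm_wallFlux_ge`).  Registered ticket: `stub_anchor_arcs`. [folklore]
-/

noncomputable section

namespace Summit.CriticalPhenomena.CardyFormulaZ2.Theorems.ParafermionFamiliesToSLESix.StripAnchored

open Finset Complex
open scoped BigOperators
open Literature.Probability.LatticeModels
open Literature.Barriers.CriticalPhenomena (medialCornersAt medialVertexOf)
open Literature.Barriers.CriticalPhenomena.HalfCRGreen (coeff twin coeff_one)
open Summit.CriticalPhenomena.CardyFormulaZ2.Cruxes.EdgePrecompact.QkzStripBoundaryArm (cornerObs)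
open S2 (sixthPhase sixthPhase_add sixthPhase_eq)

/-- `|a| + |b| = max |a + b| |a − b|` (registered ticket `stub_anchor_arcs` of the SUPPORT stub; the
tree's `Literature.Probability.Percolation.abs_add_abs_eq_max`). [folklore] -/
theorem stub_anchor_arcs : ∀ (a b : ℝ), |a| + |b| = max |a + b| |a - b| :=
  Literature.Probability.Percolation.abs_add_abs_eq_max

namespace S5

section Geometry

variable {E : DiscreteDobrushin} {L : ℤ}
  (hE : E.IsZdAdmissible)
  (hmesh : ∀ v : Site 2, v ∈ meshDomain E.Ω E.δ ↔ |v 0 + v 1| ≤ L ∧ |v 0 - v 1| ≤ L)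
  (hadj : ∀ v u : Site 2, v ∈ meshDomain E.Ω E.δ → u ∈ meshDomain E.Ω E.δ → (zdGraph 2).Adj v u →
    (discreteDomainGraph E.Ω E.δ).Adj v u)
  (hbd : ∀ v : Site 2, v ∈ E.zdBoundary ↔
    (|v 0 + v 1| ≤ L ∧ |v 0 - v 1| ≤ L) ∧ (L - 1 ≤ |v 0 + v 1| ∨ L - 1 ≤ |v 0 - v 1|))
  (hface : ∀ f : Site 2, E.IsInnerFace f ↔ |f 0 + f 1 + 1| < L ∧ |f 0 - f 1| < L)

include hmesh hbd in
/-- On the diagonal square, a mesh-domain site off the discrete boundary is a site of the inner box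
`{|s| ≤ L − 2, |d| ≤ L − 2}` (`s = v₀ + v₁`, `d = v₀ − v₁`). [folklore] -/
theorem mem_and_not_mem_zdBoundary_iff (v : Site 2) :
    (v ∈ meshDomain E.Ω E.δ ∧ v ∉ E.zdBoundary) ↔
      -(L - 2) ≤ v 0 + v 1 ∧ v 0 + v 1 ≤ L - 2 ∧ -(L - 2) ≤ v 0 - v 1 ∧ v 0 - v 1 ≤ L - 2 := by
  rw [hmesh v, hbd v]
  simp only [abs_le, le_abs]
  omega

include hE hmesh hadj hbd hface in
/-- **Interior medial vertices of the diagonal square**: `p = (x, i)` is interior iff both endpoints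
`x`, `x + eᵢ` lie in the inner box (the face clause is then automatic). [folklore] -/
theorem isInteriorMV_iff (p : Site 2 × Fin 2) :
    IsInteriorMV E p ↔
      (p.1 ∈ meshDomain E.Ω E.δ ∧ p.1 ∉ E.zdBoundary) ∧
        (p.1 + Pi.single p.2 1 ∈ meshDomain E.Ω E.δ ∧ p.1 + Pi.single p.2 1 ∉ E.zdBoundary) := by
  constructor
  · rintro ⟨h1, h2, -⟩
    have h1' : (discreteDomainGraph E.Ω E.δ).Adj p.1 (p.1 + Pi.single p.2 1) := h1
    obtain ⟨-, hx, hy⟩ := discreteDomainGraph_adj_iff.1 h1'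
    have hxA := h2 p.1 (Sym2.mem_mk_left _ _)
    have hyA := h2 (p.1 + Pi.single p.2 1) (Sym2.mem_mk_right _ _)
    refine ⟨⟨hx, fun hb => ?_⟩, ⟨hy, fun hb => ?_⟩⟩
    · rcases hE.zdBoundary_subset hb with h | h
      · exact hxA.1 h
      · exact hxA.2 h
    · rcases hE.zdBoundary_subset hb with h | h
      · exact hyA.1 h
      · exact hyA.2 h
  · rintro ⟨⟨hx, hxb⟩, ⟨hy, hyb⟩⟩
    refine ⟨?_, ?_, ?_⟩
    · show s(p.1, p.1 + Pi.single p.2 1) ∈ _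
      rw [SimpleGraph.mem_edgeSet]
      exact hadj _ _ hx hy ((zdGraph_adj_iff _ _).2 ⟨p.2, Or.inl rfl⟩)
    · intro v hv
      rcases Sym2.mem_iff.1 hv with rfl | rfl
      · exact ⟨fun h => hxb (E.zdArcA_subset_zdBoundary h), fun h => hxb (E.zdArcB_subset_zdBoundary h)⟩
      · exact ⟨fun h => hyb (E.zdArcA_subset_zdBoundary h), fun h => hyb (E.zdArcB_subset_zdBoundary h)⟩
    · intro f hf _
      rw [hface]
      have hb := (mem_and_not_mem_zdBoundary_iff hmesh hbd p.1).1 ⟨hx, hxb⟩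
      have h0 := hf 0
      have h1 := hf 1
      rw [abs_lt, abs_lt]
      omega

include hE hmesh hadj hbd hface in
/-- Interior HORIZONTAL medial vertices `(x, 0)` of the diagonal square, in level / column coordinates:
`−(L−2) ≤ s ≤ L−3`, `−(L−2) ≤ d ≤ L−3`. [folklore] -/
theorem isInteriorMV_zero_iff (x : Site 2) :
    IsInteriorMV E (x, 0) ↔
      -(L - 2) ≤ x 0 + x 1 ∧ x 0 + x 1 ≤ L - 3 ∧ -(L - 2) ≤ x 0 - x 1 ∧ x 0 - x 1 ≤ L - 3 := by
  rw [isInteriorMV_iff hE hmesh hadj hbd hface, mem_and_not_mem_zdBoundary_iff hmesh hbd,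
    mem_and_not_mem_zdBoundary_iff hmesh hbd]
  simp
  omega

include hE hmesh hadj hbd hface in
/-- Interior VERTICAL medial vertices `(x, 1)` of the diagonal square, in level / column coordinates:
`−(L−2) ≤ s ≤ L−3`, `−(L−3) ≤ d ≤ L−2`. [folklore] -/
theorem isInteriorMV_one_iff (x : Site 2) :
    IsInteriorMV E (x, 1) ↔
      -(L - 2) ≤ x 0 + x 1 ∧ x 0 + x 1 ≤ L - 3 ∧ -(L - 3) ≤ x 0 - x 1 ∧ x 0 - x 1 ≤ L - 2 := by
  rw [isInteriorMV_iff hE hmesh hadj hbd hface, mem_and_not_mem_zdBoundary_iff hmesh hbd,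
    mem_and_not_mem_zdBoundary_iff hmesh hbd]
  simp
  omega

include hE hmesh hadj hbd hface in
/-- An interior medial vertex has level `≤ L − 3`. [folklore] -/
theorem level_le_of_isInteriorMV {x : Site 2} {i : Fin 2} (h : IsInteriorMV E (x, i)) :
    x 0 + x 1 ≤ L - 3 := by
  fin_cases i
  · exact ((isInteriorMV_zero_iff hE hmesh hadj hbd hface x).1 h).2.1
  · exact ((isInteriorMV_one_iff hE hmesh hadj hbd hface x).1 h).2.1

include hE hmesh hadj hbd hface in
/-- **Twins near the wall.** For an interior medial vertex `(x, i)` of level `s ≤ L − 3` in the window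
range (`2|d| ≤ L`, `s ≥ 0`), the twins across the corners `NW`, `SE`, `SW` are interior, and the twin
across `NE` (level `s + 1`) is interior iff `s ≤ L − 4`. [folklore] -/
theorem isInteriorMV_twin_iff (hL : 8 ≤ L) {x : Site 2} {i : Fin 2} (hd : 2 * |x 0 - x 1| ≤ L)
    (hs : 0 ≤ x 0 + x 1) (hsL : x 0 + x 1 ≤ L - 3) (k : Fin 4) :
    IsInteriorMV E (twin x i k) ↔ (k = 1 → x 0 + x 1 ≤ L - 4) := by
  have hd1 := le_abs_self (x 0 - x 1)
  have hd2 := neg_abs_le (x 0 - x 1)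
  fin_cases i <;> fin_cases k <;>
    simp [twin, isInteriorMV_zero_iff hE hmesh hadj hbd hface, isInteriorMV_one_iff hE hmesh hadj hbd hface] <;>
    omega

end Geometry

/-- `Re e^{-iπ/6} = √3/2`. [folklore] -/
private theorem re_sixthPhase_one : (sixthPhase 1).re = Real.sqrt 3 / 2 := by
  rw [sixthPhase_eq]
  simp [Real.cos_pi_div_six]

/-- `Re e^{+iπ/6} = √3/2`. [folklore] -/
private theorem re_sixthPhase_neg_one : (sixthPhase (-1)).re = Real.sqrt 3 / 2 := by
  rw [sixthPhase_eq]
  simp [Real.cos_pi_div_six]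

/-- `‖sixthPhase n‖ = 1`. [folklore] -/
private theorem norm_sixthPhase (n : ℤ) : ‖sixthPhase n‖ = 1 := by
  rw [sixthPhase]
  exact Complex.norm_exp_ofReal_mul_I _

/-- From `2|a| ≤ L`: `−L ≤ 2a ≤ L`. [folklore] -/
private theorem two_mul_abs_le {a L : ℤ} (h : 2 * |a| ≤ L) : -L ≤ 2 * a ∧ 2 * a ≤ L := by
  have h0 := abs_nonneg a
  rcases abs_choice a with h' | h' <;> constructor <;> omega

/-- **The `NE` dart of a top-level medial vertex, evaluated.** For `p = (x, i)` of level `L − 3` in the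
window range, the `NE` corner observable `G E E.δ p 1 = cornerObs E E.δ (x + eᵢ) x` is the flux dart of
the wall site `w = x + eᵢ`; given the dart evaluations `hout` / `hin` it is `sixthPhase (τ ± 1) · P w`, so
`Re (sixthPhase (−τ) · G) = cos(π/6) · P w = (√3/2) · P w`. [folklore] -/
theorem re_G_one_eq {E : DiscreteDobrushin} {L τ : ℤ} {P : Site 2 → ℝ}
    (hout : ∀ w : Site 2, w 0 + w 1 = L - 2 → 2 * |w 0 - w 1| ≤ L + 2 →
      cornerObs E E.δ w (w - cornerUnit 0) = sixthPhase (τ + 1) * (P w : ℂ))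
    (hin : ∀ w : Site 2, w 0 + w 1 = L - 2 → 2 * |w 0 - w 1| ≤ L + 2 →
      cornerObs E E.δ w (w - cornerUnit 1) = sixthPhase (τ - 1) * (P w : ℂ))
    {p : Site 2 × Fin 2} (hs : p.1 0 + p.1 1 = L - 3) (hd : 2 * |p.1 0 - p.1 1| ≤ L) :
    (sixthPhase (-τ) * G E E.δ p 1).re = Real.sqrt 3 / 2 * P (p.1 + Pi.single p.2 1) := by
  obtain ⟨x, i⟩ := p
  dsimp only at hs hd ⊢
  obtain ⟨hd1, hd2⟩ := two_mul_abs_le hd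
  revert i
  rw [Fin.forall_fin_two]
  constructor
  · have e0 : (x + Pi.single 0 1 : Site 2) 0 = x 0 + 1 := by simp
    have e1 : (x + Pi.single 0 1 : Site 2) 1 = x 1 := by simp
    have h1 : (x + Pi.single 0 1 : Site 2) 0 + (x + Pi.single 0 1 : Site 2) 1 = L - 2 := by omega
    have h2 : 2 * |(x + Pi.single 0 1 : Site 2) 0 - (x + Pi.single 0 1 : Site 2) 1| ≤ L + 2 := by
      rw [e0, e1]
      rcases abs_choice (x 0 + 1 - x 1) with h | h <;> rw [h] <;> omega
    have hw := hout _ h1 h2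
    rw [show (x + Pi.single 0 1 : Site 2) - cornerUnit 0 = x by simp [cornerUnit]] at hw
    simp only [G, medialCornersAt, Matrix.cons_val_one, Matrix.cons_val_zero]
    rw [hw, ← mul_assoc, ← sixthPhase_add, show -τ + (τ + 1) = 1 by ring, mul_comm, Complex.re_ofReal_mul,
      re_sixthPhase_one, mul_comm]
  · have e0 : (x + Pi.single 1 1 : Site 2) 0 = x 0 := by simp
    have e1 : (x + Pi.single 1 1 : Site 2) 1 = x 1 + 1 := by simp
    have h1 : (x + Pi.single 1 1 : Site 2) 0 + (x + Pi.single 1 1 : Site 2) 1 = L - 2 := by omega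
    have h2 : 2 * |(x + Pi.single 1 1 : Site 2) 0 - (x + Pi.single 1 1 : Site 2) 1| ≤ L + 2 := by
      rw [e0, e1]
      rcases abs_choice (x 0 - (x 1 + 1)) with h | h <;> rw [h] <;> omega
    have hw := hin _ h1 h2
    rw [show (x + Pi.single 1 1 : Site 2) - cornerUnit 1 = x by simp [cornerUnit]] at hw
    simp only [G, medialCornersAt, Matrix.cons_val_one, Matrix.cons_val_zero]
    rw [hw, ← mul_assoc, ← sixthPhase_add, show -τ + (τ - 1) = -1 by ring, mul_comm, Complex.re_ofReal_mul,
      re_sixthPhase_neg_one, mul_comm]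

open Classical in
/-- **The wall flux at a straight diagonal free wall, unfolded and bounded below.** On the discretised
diagonal square `{|x₀+x₁| ≤ L, |x₀−x₁| ≤ L}` (hypotheses `hmesh`, `hadj`, `hbd`, `hface`), for a window `U`
seeing only medial vertices with `2|d| ≤ L`, `s ≥ 0` (`hU`), the wall flux `wallFlux χ E E.δ U` is the sum
over the interior medial vertices of level `L − 3` in `U` of `−χ ·` their `NE` dart (all other twins are
interior), i.e. of the flux darts `cornerObs E E.δ w (w − cornerUnit i) = sixthPhase (τ ± 1) · P w` of the
wall sites `w` of level `L − 2` (`hout` / `hin`); since `Re e^{∓iπ/6} = √3/2` and `P ≥ 0`, its norm is at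
least `(√3/2) · Σ_{w ∈ W} P w` for every finite set `W` of wall sites whose outgoing dart `(w − e₀, 0)` lies
in the window. [folklore] -/
theorem norm_wallFlux_ge {E : DiscreteDobrushin} (hE : E.IsZdAdmissible) {L : ℤ} (hL : 8 ≤ L)
    (hmesh : ∀ v : Site 2, v ∈ meshDomain E.Ω E.δ ↔ |v 0 + v 1| ≤ L ∧ |v 0 - v 1| ≤ L)
    (hadj : ∀ v u : Site 2, v ∈ meshDomain E.Ω E.δ → u ∈ meshDomain E.Ω E.δ → (zdGraph 2).Adj v u →
      (discreteDomainGraph E.Ω E.δ).Adj v u)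
    (hbd : ∀ v : Site 2, v ∈ E.zdBoundary ↔
      (|v 0 + v 1| ≤ L ∧ |v 0 - v 1| ≤ L) ∧ (L - 1 ≤ |v 0 + v 1| ∨ L - 1 ≤ |v 0 - v 1|))
    (hface : ∀ f : Site 2, E.IsInnerFace f ↔ |f 0 + f 1 + 1| < L ∧ |f 0 - f 1| < L)
    {χ : ℂ} (hχ : χ = Complex.I ∨ χ = -Complex.I) {U : Set ℂ}
    (hU : ∀ p : Site 2 × Fin 2, medialPoint E.δ (medialVertexOf p) ∈ U → 2 * |p.1 0 - p.1 1| ≤ L ∧ 0 ≤ p.1 0 + p.1 1)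
    (τ : ℤ) (P : Site 2 → ℝ) (hP : ∀ w, 0 ≤ P w)
    (hout : ∀ w : Site 2, w 0 + w 1 = L - 2 → 2 * |w 0 - w 1| ≤ L + 2 →
      cornerObs E E.δ w (w - cornerUnit 0) = sixthPhase (τ + 1) * (P w : ℂ))
    (hin : ∀ w : Site 2, w 0 + w 1 = L - 2 → 2 * |w 0 - w 1| ≤ L + 2 →
      cornerObs E E.δ w (w - cornerUnit 1) = sixthPhase (τ - 1) * (P w : ℂ))
    (W : Finset (Site 2))
    (hW : ∀ w ∈ W, w 0 + w 1 = L - 2 ∧ medialPoint E.δ (medialVertexOf (w - cornerUnit 0, 0)) ∈ U) :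
    Real.sqrt 3 / 2 * ∑ w ∈ W, P w ≤ ‖wallFlux χ E E.δ U‖ := by
  classical
  -- STEP 1: finite support — the interior medial vertices
  set S : Finset (Site 2 × Fin 2) := (S6.finite_interior hE).toFinset with hSdef
  have hS : ∀ p, p ∈ S ↔ IsInteriorMV E p := fun p => by
    rw [hSdef, Set.Finite.mem_toFinset, Set.mem_setOf_eq]
  -- STEPS 2–3: the wall flux is `−χ ·` the sum of the `NE` darts of the top-level vertices in the window
  have hflux : wallFlux χ E E.δ U =
      -χ * ∑ p ∈ S.filter (fun p => medialPoint E.δ (medialVertexOf p) ∈ U ∧ p.1 0 + p.1 1 = L - 3),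
        G E E.δ p 1 := by
    unfold wallFlux
    rw [finsum_eq_sum_of_support_subset (s := S), Finset.mul_sum, Finset.sum_filter]
    · refine Finset.sum_congr rfl ?_
      rintro ⟨x, i⟩ hp
      dsimp only
      have hint : IsInteriorMV E (x, i) := (hS _).1 hp
      by_cases hpU : medialPoint E.δ (medialVertexOf (x, i)) ∈ U
      · obtain ⟨hd, hs⟩ := hU (x, i) hpU
        dsimp only at hd hs
        have hsL : x 0 + x 1 ≤ L - 3 := level_le_of_isInteriorMV hE hmesh hadj hbd hface hint
        have htw := fun k => isInteriorMV_twin_iff hE hmesh hadj hbd hface hL (i := i) hd hs hsL k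
        rw [if_pos ⟨hint, hpU⟩]
        by_cases h3 : x 0 + x 1 = L - 3
        · rw [if_pos ⟨hpU, h3⟩, Fin.sum_univ_four, if_pos ((htw 0).2 fun h => absurd h (by decide)),
            if_neg (fun h => absurd ((htw 1).1 h rfl) (by omega)),
            if_pos ((htw 2).2 fun h => absurd h (by decide)), if_pos ((htw 3).2 fun h => absurd h (by decide))]
          simp only [zero_add, add_zero, coeff_one]
        · rw [if_neg (fun h => h3 h.2)]
          exact Finset.sum_eq_zero fun k _ => if_pos ((htw k).2 fun _ => by omega)
      · rw [if_neg (fun h => hpU h.2), if_neg (fun h => hpU h.1)]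
    · intro p hp
      rw [Function.mem_support] at hp
      by_contra hS'
      exact hp (if_neg fun h => hS' (Finset.mem_coe.2 ((hS p).2 h.1)))
  set T : Finset (Site 2 × Fin 2) :=
    S.filter (fun p => medialPoint E.δ (medialVertexOf p) ∈ U ∧ p.1 0 + p.1 1 = L - 3) with hTdef
  have hT : ∀ p, p ∈ T ↔ IsInteriorMV E p ∧ medialPoint E.δ (medialVertexOf p) ∈ U ∧ p.1 0 + p.1 1 = L - 3 :=
    fun p => by rw [hTdef, Finset.mem_filter, hS]
  -- STEP 4: norms — `‖χ‖ = 1`, rotate by `sixthPhase (−τ)`, take real parts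
  have hχ1 : ‖-χ‖ = 1 := by rcases hχ with rfl | rfl <;> simp
  have hrot : ‖∑ p ∈ T, G E E.δ p 1‖ = ‖∑ p ∈ T, sixthPhase (-τ) * G E E.δ p 1‖ := by
    rw [← Finset.mul_sum, norm_mul, norm_sixthPhase, one_mul]
  rw [hflux, norm_mul, hχ1, one_mul, hrot]
  refine le_trans ?_ (Complex.re_le_norm _)
  rw [Complex.re_sum, Finset.sum_congr rfl fun p hp =>
    re_G_one_eq hout hin ((hT p).1 hp).2.2 (hU p ((hT p).1 hp).2.1).1, ← Finset.mul_sum]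
  refine mul_le_mul_of_nonneg_left ?_ (by positivity)
  -- `Σ_{w ∈ W} P w ≤ Σ_{p ∈ T} P (p.1 + e_{p.2})`: `w ↦ (w − e₀, 0)` maps `W` injectively into `T`
  have hinj : ∀ a ∈ W, ∀ b ∈ W,
      (fun w : Site 2 => (w - cornerUnit 0, (0 : Fin 2))) a = (fun w : Site 2 => (w - cornerUnit 0, (0 : Fin 2))) b →
        a = b := by
    intro a _ b _ h
    simpa using congrArg Prod.fst h
  calc ∑ w ∈ W, P w
      = ∑ p ∈ W.image (fun w : Site 2 => (w - cornerUnit 0, (0 : Fin 2))), P (p.1 + Pi.single p.2 1) := by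
        rw [Finset.sum_image hinj]
        refine Finset.sum_congr rfl fun w _ => ?_
        simp [cornerUnit]
    _ ≤ ∑ p ∈ T, P (p.1 + Pi.single p.2 1) := by
        refine Finset.sum_le_sum_of_subset_of_nonneg ?_ (fun _ _ _ => hP _)
        intro p hp
        obtain ⟨w, hw, rfl⟩ := Finset.mem_image.1 hp
        obtain ⟨hws, hwU⟩ := hW w hw
        obtain ⟨hd, hs⟩ := hU _ hwU
        dsimp only at hd hs
        obtain ⟨hd1, hd2⟩ := two_mul_abs_le hd
        have e0 : (w - cornerUnit 0) 0 = w 0 - 1 := by simp [cornerUnit]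
        have e1 : (w - cornerUnit 0) 1 = w 1 := by simp [cornerUnit]
        refine (hT _).2 ⟨?_, hwU, ?_⟩
        · rw [isInteriorMV_zero_iff hE hmesh hadj hbd hface]
          omega
        · dsimp only
          omega

end S5

end Summit.CriticalPhenomena.CardyFormulaZ2.Theorems.ParafermionFamiliesToSLESix.StripAnchored

end
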